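import Literature.AnabelianGeometry.EtaleTheta.Discharge.Sec2MonodromyModelHatDottedClosuresB
import HarnessLib

/-!
# [EtTh] Prop. 2.6, PROFINITE clause, HOLDS at the monodromy model — part A: tools (completions of tempered automorphisms, conjugations,
# restriction to the rotation closure) and the cases `Ẋ̲̲` and `Ċ̲̲` (proof-only)

S. Mochizuki, *The étale theta function and its Frobenioid-theoretic manifestations* [EtTh], Publ. RIMS **45** (2009), §2
Prop. 2.6, PRIMS p. 266 = PDF p. 40: «any isomorphism of topological groups `Π^tp_{Ẋ̲̲_α} ⥲ Π^tp_{Ẋ̲̲_β}` (respectively, `Ẋ̲`; `Ċ̲̲`;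
`Ċ̲`) induces isomorphisms compatible with the various natural maps between the respective "`Π^tp`'s" of `X̲̲` (respectively, `X̲`;
`C̲̲`; `C̲`) and `Ċ`. A similar statement holds when "`Π^tp`" is replaced by "`Π`".» [cite: MochizukiEtTh2009, Prop 2.6 p.40];
Rmk. 2.6.1 p. 40 (`Aut_K(Ẋ̲̲) = μ_l × {±1}`, …) [cite: MochizukiEtTh2009, Rmk 2.6.1 p.40].
Cell abc-iut, block F (FACT-proving wave), seat abc-iut-f-142 (gen 13), FACT-LIST row **F-0611**
`ThetaCovers.TemperedCoverData.Prop26_profinite` (the last sentence of Prop. 2.6 as typed by abc-iut-L2-t2; class «universal-closure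
REFUTED / schema», abc-iut-f-143; instance form returned OPEN-SIZED by abc-iut-f-108 g4) — INSTANCE at abc-iut-w6-d084's monodromy model
`monodromyModel l hl` (tempered twin PROVED there: `prop26_monodromyModel`).

WHAT IS PROVED (parts 1–4 of this lineage supply the rotation closure `R`, the scaling automorphisms `Σ_ρ`, their stabilisation of the
tower's closures, torsion-freeness of `R` and the coset descriptions of the dotted closures BY NAME):
* tools: `comm_of_mem_A` (`A = η⟨z⟩·R` abelian), `exists_completion_of_mulEquiv` + `map_closure_eq_of_completion` (tempered
  automorphisms of `TG l` complete along `η` — abc-iut-L4's `IsProfiniteCompletion.exists_continuousMulEquiv_extending` — and stabilise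
  the closures of what they stabilise), `exists_conj_continuousMulEquiv` / `map_eq_of_conj_mem`, `exists_restrict_rot` (an automorphism of a
  closed `W ⊇ R` mapping `η t` into `R` both ways restricts to a topological automorphism of `R`);
* **`exists_hatExtension_dotXuu`** — case `Ẋ̲̲` (`Π_{Ẋ̲̲} = R`): `γ` IS the restriction of its scaling automorphism `Σ_γ`;
* **`exists_hatExtension_dotCuu`** — case `Ċ̲̲` (`Π_{Ċ̲̲} = R ∪ R·ηι ≅ D̂_∞`): `γ(R) = R` (reflections are involutions, `R` torsion-free),
  `Σ⁻¹γ(ηι) = x·ηι` with `x = ηt^ε w²`, so `γ = Σ ∘ conj(w) ∘ (halfShift(−ε))^∧` — the odd case uses abc-iut-w6-d084's OUTER tempered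
  automorphism `halfShift` («conjugation by `t^{1/2}`»).
Sequel: part B (case `Ċ̲`), then `Sec2Prop26ProfiniteTrueAtMonodromyModel.lean` (case `Ẋ̲` and `(monodromyModel l hl).Prop26_profinite`).

HONEST LABEL (abc-iut-L2-lead R1352, inherited from the carrier): «a DESIGNED tempered toy with print's monodromy combinatorics —
loop ↦ `Δ̄^ell` (`b`-cycle), the inversion INVERTS it, unipotent monodromy `x ↦ x·z` on the `a`-cycle, `z` = cusp inertia = `Δ̄_Θ`
central; `G_K := 1`; NOT a Tate curve, NOT the tempered fundamental group of a curve; consistency ≠ faithfulness.» PROOF-ONLY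
companion (0 `def`, 0 `instance`, 0 notation, 0 `Prop`-definition; nothing of abc-iut-w6-d084's model files or of abc-iut-L2-t2's
interface is edited or restated). Instance-at-OUR-carrier ≠ [EtTh] Prop. 2.6 for the profinite fundamental groups of a curve;
typed ≠ proved; no side is taken on [IUTchIII] Cor. 3.12 or on any author; nothing here asserts abc proved or refuted.
-/

noncomputable section

namespace Literature.AnabelianGeometry.EtaleTheta.ThetaCovers.MonodromyModel

open Multiplicative HeisenbergWitness TemperedModel DihedralGroup Topology
open Literature.AnabelianGeometry.SemiGraphs

variable (l : ℕ)

/-! ## 1. Tools: completions of tempered automorphisms, conjugations, restriction to `R` -/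

section Tools

/-- **`A` is abelian.** (toy bookkeeping for [EtTh] Rmk. 2.6.1 «`Π_{Ẋ̲}`»; no claim about print) [cite: MochizukiEtTh2009, Rmk 2.6.1 p.40] -/
theorem comm_of_mem_A [NeZero l] {R : Subgroup (PiC l)}
    (hR : R = ((Subgroup.zpowers (embCu l (1, r 1))).map (toHat l).toMonoidHom).topologicalClosure)
    {A : Subgroup (PiC l)}
    (hA : A = (((heisB0 l ⊓ heisPiX l).comap (PhiT l) ⊓ PiCdotT l).map (toHat l).toMonoidHom).topologicalClosure)
    {y₁ y₂ : PiC l} (h₁ : y₁ ∈ A) (h₂ : y₂ ∈ A) : y₁ * y₂ = y₂ * y₁ := by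
  obtain ⟨c₁, x₁, hx₁, rfl⟩ := (mem_closure_dotXu_iff l hR hA y₁).mp h₁
  obtain ⟨c₂, x₂, hx₂, rfl⟩ := (mem_closure_dotXu_iff l hR hA y₂).mp h₂
  calc toHat l (embCu l (c₁, 1)) * x₁ * (toHat l (embCu l (c₂, 1)) * x₂)
      = toHat l (embCu l (c₁, 1)) * (x₁ * toHat l (embCu l (c₂, 1))) * x₂ := by group
    _ = toHat l (embCu l (c₁, 1)) * (toHat l (embCu l (c₂, 1)) * x₁) * x₂ := by rw [toHat_zc_comm l c₂ x₁]
    _ = (toHat l (embCu l (c₁, 1)) * toHat l (embCu l (c₂, 1))) * (x₁ * x₂) := by group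
    _ = (toHat l (embCu l (c₂, 1)) * toHat l (embCu l (c₁, 1))) * (x₂ * x₁) := by
        rw [comm_of_mem_rot l hR hx₁ hx₂, toHat_zc_comm l c₁ (toHat l (embCu l (c₂, 1)))]
    _ = toHat l (embCu l (c₂, 1)) * (toHat l (embCu l (c₁, 1)) * x₂) * x₁ := by group
    _ = toHat l (embCu l (c₂, 1)) * (x₂ * toHat l (embCu l (c₁, 1))) * x₁ := by rw [toHat_zc_comm l c₁ x₂]
    _ = toHat l (embCu l (c₂, 1)) * x₂ * (toHat l (embCu l (c₁, 1)) * x₁) := by group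

/-- **Tempered automorphisms complete**: every automorphism `Γ₀` of the discrete `Π^tp_C = TG l` extends to a topological
automorphism of `Π_C` along `η` (abc-iut-L4/w5-d139's `IsProfiniteCompletion.exists_continuousMulEquiv_extending`).
(toy bookkeeping for [EtTh] §1 p. 12 «`Π_X := (Π^tp_X)^∧`»; no claim about print) [cite: MochizukiEtTh2009, §1 p.12] -/
theorem exists_completion_of_mulEquiv (Γ₀ : TG l ≃* TG l) :
    ∃ Γ : PiC l ≃ₜ* PiC l, ∀ g : TG l, Γ (toHat l g) = toHat l (Γ₀ g) := by
  obtain ⟨Γ₀', hΓ₀'⟩ := exists_continuousMulEquiv_of_mulEquiv l Γ₀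
  obtain ⟨Γ, hΓ⟩ := (isProfiniteCompletion_toHat l).exists_continuousMulEquiv_extending Γ₀'
  exact ⟨Γ, fun g => by rw [hΓ, hΓ₀']⟩

/-- A completed tempered automorphism stabilises the closure of `η(S)` when the tempered one stabilises `S`.
(toy bookkeeping; no claim about print) [cite: MochizukiEtTh2009, Prop 2.6 p.40] -/
theorem map_closure_eq_of_completion (Γ : PiC l ≃ₜ* PiC l) (Γ₀ : TG l ≃* TG l) (hΓ : ∀ g : TG l, Γ (toHat l g) = toHat l (Γ₀ g))
    (S : Subgroup (TG l)) (hS : S.map Γ₀.toMonoidHom = S) :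
    ((S.map (toHat l).toMonoidHom).topologicalClosure).map Γ.toMulEquiv.toMonoidHom =
      (S.map (toHat l).toMonoidHom).topologicalClosure := by
  apply SetLike.coe_injective
  rw [Subgroup.coe_map, Subgroup.topologicalClosure_coe, MulEquiv.coe_toMonoidHom, ContinuousMulEquiv.toMulEquiv_eq_coe]
  change (Γ : PiC l ≃ₜ PiC l) '' _ = _
  rw [Homeomorph.image_closure]
  congr 1
  ext y
  constructor
  · rintro ⟨_, ⟨g, hg, rfl⟩, rfl⟩
    refine ⟨Γ₀ g, ?_, ?_⟩
    · rw [← hS]; exact ⟨g, hg, rfl⟩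
    · change toHat l (Γ₀ g) = Γ (toHat l g); rw [hΓ]
  · rintro ⟨g, hg, rfl⟩
    rw [← hS] at hg
    obtain ⟨g', hg', rfl⟩ := hg
    exact ⟨toHat l g', ⟨g', hg', rfl⟩, hΓ g'⟩

/-- **Conjugations** as topological automorphisms of `Π_C`. (folklore; no claim about print) [cite: MochizukiEtTh2009, Prop 2.6 p.40] -/
theorem exists_conj_continuousMulEquiv (w : PiC l) : ∃ C : PiC l ≃ₜ* PiC l, ∀ y, C y = w * y * w⁻¹ :=
  ⟨{ MulAut.conj w with
      continuous_toFun := (continuous_const.mul continuous_id).mul continuous_const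
      continuous_invFun := (continuous_const.mul continuous_id).mul continuous_const }, fun _ => rfl⟩

/-- Conjugation by an element of a subgroup stabilises it. (folklore; no claim about print) [cite: MochizukiEtTh2009, Prop 2.6 p.40] -/
theorem map_eq_of_conj_mem (C : PiC l ≃ₜ* PiC l) (w : PiC l) (hC : ∀ y, C y = w * y * w⁻¹) (K : Subgroup (PiC l))
    (hw : w ∈ K) : K.map C.toMulEquiv.toMonoidHom = K := by
  refine le_antisymm ?_ fun y hy => ?_
  · rintro _ ⟨y, hy, rfl⟩
    change C y ∈ K
    rw [hC]
    exact K.mul_mem (K.mul_mem hw hy) (K.inv_mem hw)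
  · refine ⟨w⁻¹ * y * w, K.mul_mem (K.mul_mem (K.inv_mem hw) hy) hw, ?_⟩
    change C _ = y
    rw [hC]
    group

/-- Composition of stabilisations. (folklore; no claim about print) [cite: MochizukiEtTh2009, Prop 2.6 p.40] -/
theorem map_ctrans_eq (e₁ e₂ : PiC l ≃ₜ* PiC l) (K : Subgroup (PiC l)) (h₁ : K.map e₁.toMulEquiv.toMonoidHom = K)
    (h₂ : K.map e₂.toMulEquiv.toMonoidHom = K) : K.map (e₁.trans e₂).toMulEquiv.toMonoidHom = K := by
  rw [show (e₁.trans e₂).toMulEquiv.toMonoidHom = e₂.toMulEquiv.toMonoidHom.comp e₁.toMulEquiv.toMonoidHom from rfl,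
    ← Subgroup.map_map, h₁, h₂]

/-- **Restriction to the rotation closure.** A topological automorphism `γ` of a closed subgroup `W ⊇ R` with `γ(η t), γ⁻¹(η t) ∈ R`
restricts to a topological automorphism of `R`. (toy bookkeeping; no claim about print) [cite: MochizukiEtTh2009, Prop 2.6 p.40] -/
theorem exists_restrict_rot {R : Subgroup (PiC l)}
    (hR : R = ((Subgroup.zpowers (embCu l (1, r 1))).map (toHat l).toMonoidHom).topologicalClosure)
    {W : Subgroup (PiC l)} (hRW : R ≤ W) (γ : ↥W ≃ₜ* ↥W)
    (h1 : (γ ⟨toHat l (embCu l (1, r 1)), hRW (toHat_t_mem l hR)⟩ : PiC l) ∈ R)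
    (h2 : (γ.symm ⟨toHat l (embCu l (1, r 1)), hRW (toHat_t_mem l hR)⟩ : PiC l) ∈ R) :
    ∃ ρ : ↥R ≃ₜ* ↥R, (∀ x : ↥R, (ρ x : PiC l) = γ ⟨x, hRW x.2⟩) ∧ ∀ x : ↥R, (ρ.symm x : PiC l) = γ.symm ⟨x, hRW x.2⟩ := by
  have hRcl : IsClosed (R : Set (PiC l)) := by rw [hR]; exact Subgroup.isClosed_topologicalClosure _
  -- both `γ` and `γ⁻¹` map `R` into `R`
  have key : ∀ (δ : ↥W ≃ₜ* ↥W), (δ ⟨toHat l (embCu l (1, r 1)), hRW (toHat_t_mem l hR)⟩ : PiC l) ∈ R →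
      ∀ x : ↥R, (δ ⟨x, hRW x.2⟩ : PiC l) ∈ R := by
    intro δ hδ x
    subst hR
    refine closed_subset_closure_eq_univ ((Subgroup.zpowers (embCu l (1, r 1))).map (toHat l).toMonoidHom)
      (P := (fun x : ↥((Subgroup.zpowers (embCu l (1, r 1))).map (toHat l).toMonoidHom).topologicalClosure =>
        (δ ⟨x, hRW x.2⟩ : PiC l)) ⁻¹'
          ((((Subgroup.zpowers (embCu l (1, r 1))).map (toHat l).toMonoidHom).topologicalClosure : Subgroup (PiC l)) :
            Set (PiC l))) (hRcl.preimage ?_) (fun y hy => ?_) x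
    · exact continuous_subtype_val.comp (δ.continuous.comp (continuous_subtype_val.subtype_mk _))
    · obtain ⟨k, rfl⟩ := (mem_map_zpowers_iff l).mp hy
      have e : (⟨toHat l (embCu l (1, r 1) ^ k), hRW (Subgroup.le_topologicalClosure _ hy)⟩ : ↥W) =
          ⟨toHat l (embCu l (1, r 1)), hRW (toHat_t_mem l rfl)⟩ ^ k := by
        apply Subtype.ext; simp only [SubgroupClass.coe_zpow, map_zpow]
      change (δ ⟨toHat l (embCu l (1, r 1) ^ k), _⟩ : PiC l) ∈
        (((Subgroup.zpowers (embCu l (1, r 1))).map (toHat l).toMonoidHom).topologicalClosure : Subgroup (PiC l))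
      rw [e, map_zpow, SubgroupClass.coe_zpow]
      exact Subgroup.zpow_mem _ hδ k
  have k1 := key γ h1
  have k2 := key γ.symm h2
  let f : ↥R → ↥R := fun x => ⟨γ ⟨x, hRW x.2⟩, k1 x⟩
  let g : ↥R → ↥R := fun x => ⟨γ.symm ⟨x, hRW x.2⟩, k2 x⟩
  have hfg : Function.LeftInverse g f := fun x => by
    apply Subtype.ext
    change ((γ.symm ⟨(γ ⟨x, hRW x.2⟩ : PiC l), _⟩ : ↥W) : PiC l) = x
    rw [show (⟨(γ ⟨x, hRW x.2⟩ : PiC l), hRW (k1 x)⟩ : ↥W) = γ ⟨x, hRW x.2⟩ from Subtype.ext rfl,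
      ContinuousMulEquiv.symm_apply_apply]
  have hgf : Function.RightInverse g f := fun x => by
    apply Subtype.ext
    change ((γ ⟨(γ.symm ⟨x, hRW x.2⟩ : PiC l), _⟩ : ↥W) : PiC l) = x
    rw [show (⟨(γ.symm ⟨x, hRW x.2⟩ : PiC l), hRW (k2 x)⟩ : ↥W) = γ.symm ⟨x, hRW x.2⟩ from Subtype.ext rfl,
      ContinuousMulEquiv.apply_symm_apply]
  have hmul : ∀ x y, f (x * y) = f x * f y := fun x y => by
    apply Subtype.ext
    change (γ ⟨(x : PiC l) * y, hRW (x * y).2⟩ : PiC l) = γ ⟨x, _⟩ * γ ⟨y, _⟩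
    rw [show (⟨(x : PiC l) * y, hRW (x * y).2⟩ : ↥W) = ⟨x, hRW x.2⟩ * ⟨y, hRW y.2⟩ from Subtype.ext rfl, map_mul,
      Subgroup.coe_mul]
  have hcf : Continuous f :=
    (continuous_subtype_val.comp (γ.continuous.comp (continuous_subtype_val.subtype_mk _))).subtype_mk _
  have hcg : Continuous g :=
    (continuous_subtype_val.comp (γ.symm.continuous.comp (continuous_subtype_val.subtype_mk _))).subtype_mk _
  let ρ : ↥R ≃ₜ* ↥R :=
    { toFun := f
      invFun := g
      left_inv := hfg
      right_inv := hgf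
      map_mul' := hmul
      continuous_toFun := hcf
      continuous_invFun := hcg }
  exact ⟨ρ, fun x => rfl, fun x => rfl⟩

end Tools

/-! ## 2. The cases `Ẋ̲̲` and `Ċ̲̲` -/

section Cases

/-- `Π^tp_{Ẋ̲̲} = ⟨t⟩`. (toy bookkeeping for [EtTh] Def. 2.5 (ii) «`Ẋ̲̲`»; no claim about print) [cite: MochizukiEtTh2009, Def 2.5(ii) p.39] -/
theorem dotXuu_eq_zpowers : (heisD l ⊓ heisPiX l).comap (PhiT l) ⊓ PiCdotT l = Subgroup.zpowers (embCu l (1, r 1)) := by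
  rw [← range_embCu_inr_zpowers]
  ext g
  constructor
  · rintro ⟨n, rfl⟩
    refine Subgroup.mem_zpowers_iff.mpr ⟨Multiplicative.toAdd n, ?_⟩
    simp only [MonoidHom.comp_apply, zpowersHom_apply, MonoidHom.inr_apply]
    rw [← map_zpow, Prod.pow_mk, one_zpow]
  · intro hg
    obtain ⟨k, rfl⟩ := Subgroup.mem_zpowers_iff.mp hg
    refine ⟨Multiplicative.ofAdd k, ?_⟩
    simp only [MonoidHom.comp_apply, zpowersHom_apply, MonoidHom.inr_apply, toAdd_ofAdd]
    rw [← map_zpow, Prod.pow_mk, one_zpow]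

/-- `(x · η ι)² = 1` for `x ∈ R` (the reflections of `D = cl(η Π^tp_{Ċ̲̲})` are involutions). (toy bookkeeping; no claim about print)
[cite: MochizukiEtTh2009, Prop 2.6 p.40] -/
theorem rot_mul_iotaM_sq [NeZero l] {R : Subgroup (PiC l)}
    (hR : R = ((Subgroup.zpowers (embCu l (1, r 1))).map (toHat l).toMonoidHom).topologicalClosure)
    {x : PiC l} (hx : x ∈ R) : (x * iotaM l) ^ 2 = 1 := by
  have h := zc_mul_rot_mul_iotaM_sq l hR 1 hx
  rwa [one_pow, show ((1 : Multiplicative (ZMod l)), (1 : DihedralGroup 0)) = 1 from rfl, map_one, map_one, one_mul] at h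

/-- **Case `Ẋ̲̲`** (`Π_{Ẋ̲̲} = cl(η⟨t⟩) = R`): every topological automorphism of `R` extends to `Π_C` stabilising the closures of
`Π^tp_{Ẋ̲̲}`, `Π^tp_{X̲̲}`, `Π^tp_Ċ` — it IS the restriction of its scaling automorphism `Σ_γ`. (the typed [EtTh] Prop. 2.6, profinite
clause, case `Ẋ̲̲`, AT THE MODEL; no claim about print) [cite: MochizukiEtTh2009, Prop 2.6 p.40] -/
theorem exists_hatExtension_dotXuu [NeZero l] {Z : Subgroup (TG l)} (hZ : Z = (heisD l ⊓ heisPiX l).comap (PhiT l))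
    {W : Subgroup (PiC l)} (hW : W = ((Z ⊓ PiCdotT l).map (toHat l).toMonoidHom).topologicalClosure) (γ : ↥W ≃ₜ* ↥W) :
    ∃ Γ : PiC l ≃ₜ* PiC l, (∀ h : ↥W, Γ h = γ h) ∧
      W.map Γ.toMulEquiv.toMonoidHom = W ∧
      ((Z.map (toHat l).toMonoidHom).topologicalClosure).map Γ.toMulEquiv.toMonoidHom =
        (Z.map (toHat l).toMonoidHom).topologicalClosure ∧
      (((PiCdotT l).map (toHat l).toMonoidHom).topologicalClosure).map Γ.toMulEquiv.toMonoidHom =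
        ((PiCdotT l).map (toHat l).toMonoidHom).topologicalClosure := by
  subst hZ
  have hR : W = ((Subgroup.zpowers (embCu l (1, r 1))).map (toHat l).toMonoidHom).topologicalClosure := by
    rw [hW, dotXuu_eq_zpowers]
  obtain ⟨Sg, hSR, -, -, -, -, hSstab⟩ := exists_hatScalingEquiv_stabilising l hR γ
  have hZc := coordClosed_inf l (coordClosed_heisD l) (coordClosed_heisPiX l)
  rw [← Subgroup.comap_inf] at hZc
  refine ⟨Sg, hSR, ?_, hSstab _ hZc, hSstab _ (coordClosed_PiCdotT l)⟩
  rw [hW]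
  exact hSstab _ (coordClosed_inf l hZc (coordClosed_PiCdotT l))

/-- **Case `Ċ̲̲`** (`Π_{Ċ̲̲} = D = R ∪ R · η ι ≅ D̂_∞`): every topological automorphism `γ` of `D` extends to `Π_C` stabilising the
closures of `Π^tp_{Ċ̲̲}`, `Π^tp_{C̲̲}`, `Π^tp_Ċ`. `γ` preserves `R` (its reflections are involutions, `R` is torsion-free), so
`γ|_R = Σ|_R` for a scaling automorphism `Σ`; then `Σ⁻¹ γ(η ι) = x · η ι` with `x = w²` or `η t · w²` (`w ∈ R`), i.e. `Σ⁻¹ γ` is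
conjugation by `w` composed with the completion of `id` resp. of the tempered outer automorphism `halfShift (−1)` («conjugation by
`t^{1/2}`»). (the typed [EtTh] Prop. 2.6, profinite clause, case `Ċ̲̲`, AT THE MODEL; no claim about print) [cite: MochizukiEtTh2009, Prop 2.6 p.40] -/
theorem exists_hatExtension_dotCuu [NeZero l] (hl : Odd l) {Z : Subgroup (TG l)} (hZ : Z = (heisD l).comap (PhiT l))
    {D : Subgroup (PiC l)} (hD : D = ((Z ⊓ PiCdotT l).map (toHat l).toMonoidHom).topologicalClosure) (γ : ↥D ≃ₜ* ↥D) :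
    ∃ Γ : PiC l ≃ₜ* PiC l, (∀ h : ↥D, Γ h = γ h) ∧
      D.map Γ.toMulEquiv.toMonoidHom = D ∧
      ((Z.map (toHat l).toMonoidHom).topologicalClosure).map Γ.toMulEquiv.toMonoidHom =
        (Z.map (toHat l).toMonoidHom).topologicalClosure ∧
      (((PiCdotT l).map (toHat l).toMonoidHom).topologicalClosure).map Γ.toMulEquiv.toMonoidHom =
        ((PiCdotT l).map (toHat l).toMonoidHom).topologicalClosure := by
  subst hZ
  set R := ((Subgroup.zpowers (embCu l (1, r 1))).map (toHat l).toMonoidHom).topologicalClosure with hR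
  have hRD : R ≤ D := fun y hy => ((mem_closure_dotCuu_iff l hR hD y).mpr ⟨y, hy, Or.inl rfl⟩)
  have htD : toHat l (embCu l (1, r 1)) ∈ D := hRD (toHat_t_mem l hR)
  have hιD : iotaM l ∈ D := by
    have := (mem_closure_dotCuu_iff l hR hD (1 * iotaM l)).mpr ⟨1, R.one_mem, Or.inr rfl⟩
    rwa [one_mul] at this
  -- Step 1: every automorphism of `D` maps `η t` into `R`
  have step1 : ∀ δ : ↥D ≃ₜ* ↥D, (δ ⟨toHat l (embCu l (1, r 1)), htD⟩ : PiC l) ∈ R := by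
    intro δ
    obtain ⟨x, hx, h | h⟩ := (mem_closure_dotCuu_iff l hR hD _).mp (δ ⟨toHat l (embCu l (1, r 1)), htD⟩).2
    · rw [h]; exact hx
    · exfalso
      have h2 : (δ ⟨toHat l (embCu l (1, r 1)), htD⟩) ^ 2 = 1 := by
        apply Subtype.ext
        rw [SubgroupClass.coe_pow, h, rot_mul_iotaM_sq l hR hx]
        rfl
      rw [← map_pow, ← map_one δ, δ.apply_eq_iff_eq] at h2
      have h3 : toHat l (embCu l (1, r 1)) ^ 2 = 1 := by
        have := congrArg Subtype.val h2
        rwa [SubgroupClass.coe_pow] at this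
      exact toHat_t_ne_one l (eq_one_of_pow_eq_one_of_mem_rot l hR (toHat_t_mem l hR) two_ne_zero h3)
  -- Step 2: restrict to `R`, take the scaling automorphism
  obtain ⟨ρ, hρ, hρ'⟩ := exists_restrict_rot l hR hRD γ (step1 γ) (step1 γ.symm)
  obtain ⟨Sg, hSR, hSR', hSι, -, -, hSstab⟩ := exists_hatScalingEquiv_stabilising l hR ρ
  have hDc : (embCu l (1, r 1) ∈ (heisD l).comap (PhiT l) ⊓ PiCdotT l ∧ _ ∧ _) :=
    coordClosed_inf l (coordClosed_heisD l) (coordClosed_PiCdotT l)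
  have hSD : D.map Sg.toMulEquiv.toMonoidHom = D := by rw [hD]; exact hSstab _ hDc
  -- Step 3: `y := Σ⁻¹ γ(η ι) = x · η ι` with `x ∈ R`
  set y := Sg.symm (γ ⟨iotaM l, hιD⟩ : PiC l) with hy
  have hyD : y ∈ D := by
    have : (γ ⟨iotaM l, hιD⟩ : PiC l) ∈ D.map Sg.toMulEquiv.toMonoidHom := by rw [hSD]; exact (γ _).2
    obtain ⟨d, hd, hd'⟩ := this
    rw [hy, ← hd']
    change Sg.symm (Sg d) ∈ D
    rwa [Sg.symm_apply_apply]
  have hι2 : (⟨iotaM l, hιD⟩ : ↥D) ^ 2 = 1 := Subtype.ext (by rw [SubgroupClass.coe_pow, pow_two, iotaM_mul_self]; rfl)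
  have hy2 : y ^ 2 = 1 := by
    rw [hy, ← map_pow, ← SubgroupClass.coe_pow, ← map_pow, hι2, map_one, OneMemClass.coe_one, map_one]
  obtain ⟨x, hx, hxy⟩ : ∃ x ∈ R, y = x * iotaM l := by
    obtain ⟨x, hx, h | h⟩ := (mem_closure_dotCuu_iff l hR hD y).mp hyD
    · exfalso
      have hy1 : y = 1 := eq_one_of_pow_eq_one_of_mem_rot l hR (h ▸ hx) two_ne_zero hy2
      have : (γ ⟨iotaM l, hιD⟩ : PiC l) = 1 := by
        rw [show (γ ⟨iotaM l, hιD⟩ : PiC l) = Sg y by rw [hy, Sg.apply_symm_apply], hy1, map_one]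
      have h4 : γ ⟨iotaM l, hιD⟩ = 1 := Subtype.ext this
      rw [← map_one γ, γ.apply_eq_iff_eq] at h4
      exact iotaM_ne_one l (congrArg Subtype.val h4)
    · exact ⟨x, hx, h⟩
  -- Step 4: `x = η t^ε · w²`, `ε ∈ {0, 1}`
  obtain ⟨w, hw, hxw⟩ := exists_sq_or_t_mul_sq_of_mem_rot l hR hx
  obtain ⟨ε, hε⟩ : ∃ ε : ℤ, x = toHat l (embCu l (1, r 1)) ^ ε * w ^ 2 := by
    rcases hxw with h | h
    · exact ⟨0, by rw [zpow_zero, one_mul]; exact h⟩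
    · exact ⟨1, by rw [zpow_one]; exact h⟩
  -- Step 5: the tempered part and the conjugation
  let Γ₀ : TG l ≃* TG l := halfShift l hl (-(show ZMod 0 from ε))
  have hΓ₀t : ∀ k : ℤ, Γ₀ (embCu l (1, r 1) ^ k) = embCu l (1, r 1) ^ k := fun k => by
    rw [map_zpow]; congr 1; change halfShift l hl _ _ = _; rw [halfShift_embCu, dihedralShift_r]
  have hΓ₀ι : Γ₀ (iotaT l) = embCu l (1, r 1) ^ ε * iotaT l := by
    change halfShift l hl _ (embCu l (1, sr 0)) = _
    rw [halfShift_embCu, dihedralShift_sr, zero_add, (embCu_one_dihedral l _).2, iotaT_mul_t_zpow, ← zpow_neg]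
    congr 2
    change -(-ε) = ε
    rw [neg_neg]
  obtain ⟨Γh, hΓh⟩ := exists_completion_of_mulEquiv l Γ₀
  obtain ⟨Cw, hCw⟩ := exists_conj_continuousMulEquiv l w
  refine ⟨Γh.trans (Cw.trans Sg), ?_, ?_, ?_, ?_⟩
  · -- agreement on `D`: by density from `η(Π^tp_{Ċ̲̲})`
    have hwR : ∀ z ∈ R, Cw z = z := fun z hz => by
      rw [hCw, comm_of_mem_rot l hR hw hz, mul_inv_cancel_right]
    have ht : ∀ k : ℤ, (Γh.trans (Cw.trans Sg)) (toHat l (embCu l (1, r 1) ^ k)) =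
        γ ⟨toHat l (embCu l (1, r 1) ^ k), hRD (toHat_t_zpow_mem l hR k)⟩ := by
      intro k
      rw [ContinuousMulEquiv.trans_apply, ContinuousMulEquiv.trans_apply, hΓh, hΓ₀t, hwR _ (toHat_t_zpow_mem l hR k)]
      exact (hSR ⟨_, toHat_t_zpow_mem l hR k⟩).trans (hρ ⟨_, toHat_t_zpow_mem l hR k⟩)
    have hι : (Γh.trans (Cw.trans Sg)) (iotaM l) = γ ⟨iotaM l, hιD⟩ := by
      rw [ContinuousMulEquiv.trans_apply, ContinuousMulEquiv.trans_apply]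
      conv_lhs => rw [show iotaM l = toHat l (iotaT l) from rfl]
      rw [hΓh, hΓ₀ι, map_mul, map_zpow, show toHat l (iotaT l) = iotaM l from rfl]
      have hT : toHat l (embCu l (1, r 1)) ^ ε ∈ R := R.zpow_mem (toHat_t_mem l hR) ε
      have hTw : w * toHat l (embCu l (1, r 1)) ^ ε = toHat l (embCu l (1, r 1)) ^ ε * w := comm_of_mem_rot l hR hw hT
      have hιw : iotaM l * w⁻¹ * (iotaM l)⁻¹ = w := by rw [iotaM_conj_of_mem_rot l hR (R.inv_mem hw), inv_inv]
      have e1 : Cw (toHat l (embCu l (1, r 1)) ^ ε * iotaM l) = x * iotaM l := by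
        rw [hCw]
        calc w * (toHat l (embCu l (1, r 1)) ^ ε * iotaM l) * w⁻¹
            = (w * toHat l (embCu l (1, r 1)) ^ ε) * (iotaM l * w⁻¹ * (iotaM l)⁻¹) * iotaM l := by group
          _ = (toHat l (embCu l (1, r 1)) ^ ε * w) * w * iotaM l := by rw [hTw, hιw]
          _ = x * iotaM l := by rw [hε, pow_two, mul_assoc _ w w]
      rw [e1, ← hxy, hy, Sg.apply_symm_apply]
    intro h
    subst hD
    have key := eq_of_eqOn_subgroup_of_continuous (((heisD l).comap (PhiT l) ⊓ PiCdotT l).map (toHat l).toMonoidHom)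
      (f := fun h => (Γh.trans (Cw.trans Sg)) (h : PiC l)) (g := fun h => (γ h : PiC l))
      ((map_continuous _).comp continuous_subtype_val) (continuous_subtype_val.comp γ.continuous) ?_
    · exact congrFun key h
    · intro q hq
      have hqD : q ∈ ((((heisD l).comap (PhiT l)) ⊓ PiCdotT l).map (toHat l).toMonoidHom).topologicalClosure :=
        Subgroup.le_topologicalClosure _ hq
      obtain ⟨g, hg, rfl⟩ := hq
      rw [← range_embCu_inr] at hg
      obtain ⟨d, rfl⟩ := hg
      rcases d with i | i
      · change (Γh.trans (Cw.trans Sg)) (toHat l (embCu l (1, r i))) = γ ⟨toHat l (embCu l (1, r i)), _⟩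
        have e := (embCu_one_dihedral l i).1
        simp only [e]
        exact ht _
      · change (Γh.trans (Cw.trans Sg)) (toHat l (embCu l (1, sr i))) = γ ⟨toHat l (embCu l (1, sr i)), _⟩
        have e := (embCu_one_dihedral l i).2
        have hm : (⟨toHat l (embCu l (1, sr i)), hqD⟩ :
            ↥((((heisD l).comap (PhiT l)) ⊓ PiCdotT l).map (toHat l).toMonoidHom).topologicalClosure) =
            ⟨iotaM l, hιD⟩ * ⟨toHat l (embCu l (1, r 1) ^ (show ℤ from i)), hRD (toHat_t_zpow_mem l hR _)⟩ :=
          Subtype.ext (by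
            change toHat l (embCu l (1, sr i)) = iotaM l * toHat l (embCu l (1, r 1) ^ (show ℤ from i))
            rw [e, map_mul]; rfl)
        rw [hm, map_mul, Subgroup.coe_mul, ← hι, ← ht, ← map_mul, e, map_mul, iotaM]
  · rw [hD] at hSD hRD ⊢
    exact map_ctrans_eq l _ _ _ (map_closure_eq_of_completion l Γh Γ₀ hΓh _ (by
      rw [Subgroup.map_inf_eq _ _ Γ₀.toMonoidHom Γ₀.injective, (halfShift_stabilises l hl _).2.1,
        (halfShift_stabilises l hl _).2.2.2]))
      (map_ctrans_eq l _ _ _ (map_eq_of_conj_mem l Cw w hCw _ (hRD hw)) hSD)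
  · exact map_ctrans_eq l _ _ _ (map_closure_eq_of_completion l Γh Γ₀ hΓh _ (halfShift_stabilises l hl _).2.1)
      (map_ctrans_eq l _ _ _ (map_eq_of_conj_mem l Cw w hCw _ (by
        refine (show R ≤ _ from ?_) hw
        rw [hR]
        exact Subgroup.topologicalClosure_mono (Subgroup.map_mono ((Subgroup.zpowers_le).mpr (coordClosed_heisD l).1))))
        (hSstab _ (coordClosed_heisD l)))
  · exact map_ctrans_eq l _ _ _ (map_closure_eq_of_completion l Γh Γ₀ hΓh _ (halfShift_stabilises l hl _).2.2.2)
      (map_ctrans_eq l _ _ _ (map_eq_of_conj_mem l Cw w hCw _ (by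
        refine (show R ≤ _ from ?_) hw
        rw [hR]
        exact Subgroup.topologicalClosure_mono (Subgroup.map_mono ((Subgroup.zpowers_le).mpr (coordClosed_PiCdotT l).1))))
        (hSstab _ (coordClosed_PiCdotT l)))

end Cases

end Literature.AnabelianGeometry.EtaleTheta.ThetaCovers.MonodromyModel

end
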